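import Summits.BirchSwinnertonDyer.Rank1Residual.X2.RankOneParitySqueeze
import Summits.BirchSwinnertonDyer.BirchSwinnertonDyer.Theorems.EisensteinPrimesB11L3Door
import Literature.NumberTheory.EllipticCurves.SteinWuthrich2013.SplitMultCanonicalHolds
import Literature.NumberTheory.EllipticCurves.SteinWuthrich2013.NonsplitMultCanonicalHolds
import HarnessLib

/-!
# Row B11 ∩ SPLIT, λ_an = 4 (both ψ-parities): the KELLER–YIN-FREE per-pair road «route P at a
# split prime» as ONE door — Mazur's cyclotomic main conjecture at an X2c pair with SPLIT
# multiplicative `p` from `(μ_an, λ_an) = (0, 4)`, a certified lower bound `k ≤ ord_p 𝓛_p`, a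
# certified lower bound `v ≤ ord_p Reg_p` of THE Stein–Wuthrich §4.2 (split) height and the
# Tamagawa/torsion inequality `2 + 2·ord_p #tors < k + v + ord_p ∏c_ℓ`
# (cell `bsd-eis`, seat `bsd-eis-k5-c4` gen 10; route `EisensteinPrimes`, crux 4 `BSDpOnCellC` =
# stmt-BirchSwinnertonDyer-19034; THEOREMS ONLY — no definition, no new named fact)

HONEST FRAMING (FULL-BSD rank-≤1 programme D-0033, cell `bsd-eis`, home `run/shared/lean/pub/bsd-eis/`;
row B11 = X2c: `r_an = 1`, `p` odd, `p ‖ N`, `E[p]` reducible; O9 atlas `class-closure/O9/E2-hypotheses.tsv`).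
Per-pair CONDITIONAL theorems: the class-level inputs are the tree's registered PUBLISHED facts BY NAME,
the per-pair inputs are instrument READINGS. Nothing is booked here and no label or count moves (the
referee's word at an offer does that); X2c stays CONSTRUCTION-SHAPED as a class (crux 4 is OPEN and its
four registered stubs are untouched); BSD is proved for no curve by this file unconditionally.

WHY THIS FILE. Gen 9 of this seat landed the NON-split route-P door
(`Theorems/EisensteinPrimesB11NonsplitRoutePDoor.lean`: `(μ_an, λ_an) = (0, 3)` + one height reading +
the inequality ⟹ Mazur's main conjecture AND `BSD(E,p)`) and left the split branch as successor item
(k5-c4 MEMO-7 §5 V9). b2b gen 5's `X2.cellC_mazurMainConjectureAt_of_routeP`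
(`X2/RankOneParitySqueeze.lean`) already carries the SPLIT branch at data level: at a split prime the
trivial zero counts (`e = 1`), so λ-excess `2` means `λ_an = 4`; Kato–Wuthrich divisibility
`ϖ·L = ι(T·h·f_E)` (Wuthrich 2014 Thm. 16) + Greenberg's parity `corank Sel ≡ λ(f_E) (mod 2)` (LNM 1716
Prop. 3.10) squeeze `λ(f_E) ∈ {1, 3}`; `λ(f_E) = 1` would make THE §4.2 height non-degenerate with
`[T¹]f_E ∈ ℤ_pˣ`, and Stein–Wuthrich Thm. 6.1 (3) — `[T¹]f_E · log_p(κγ)² · #tors² ∼ 𝓛_p · #Ш[p^∞] · Reg_p · ∏c_ℓ`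
— would force `2 + 2·ord_p #tors ≥ k + v + ord_p ∏c_ℓ` for any certified `k ≤ ord_p 𝓛_p`,
`v ≤ ord_p Reg_p`; so the READ inequality `2 + 2·ord_p #tors < k + v + ord_p ∏c_ℓ` gives `λ(f_E) = 3`,
`λ(h) = 0`, `h ∈ Λˣ`: Mazur's main conjecture at the pair. This file states that branch as a door in the
grammar of the booked per-pair roads, with the existence facts `exists_isSplitMultCanonical` /
`exists_isMultCanonical` (THE §4.2 heights exist) DISCHARGED by the tree theorems `…_holds`
(k5-c4 g3 / b2b).

WHAT THE SPLIT BRANCH DOES NOT GIVE. Unlike the non-split door, `BSD(E,p)` does NOT follow from the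
main conjecture + Schneider at a split pair on the published record: the exceptional-zero rank-one
leading term for reducible `E[p]` is the typed conjecture `O9.ExceptionalLeadingTermAt` (in print only
for irreducible `E[p]`, `p ≥ 5`: Disegni 2020 Thm. 4 ⇐ Venerucci 2016; see `X2/ClassClosureO9.lean`
§(b)). `BSD(E,p)` at these cells is the business of the descent road (k5-p4, referee B R796
`T-EISX2D3`) or of the L3 certificate (k5-p3's door `B11L3.bsdp_of_cellC_of_split_of_thm16_of_l3Certificate`,
which needs the `[T²]` reading); §3 below merely packages route P with the L3 door for a display that
has both readings. The value added by this file is the MAIN-CONJECTURE instance at a rank-one SPLIT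
multiplicative Eisenstein pair — in print for no class of such pairs (Greenberg–Vatsal 2000 is good
ordinary; Keller–Yin 2024 Thm. 5.0.4 is anticyclotomic and PRE).

* §1 `mazurMC_of_cellC_of_split_of_routeP` — the door: `CellC W p ∧ split`, READ `hμ0 : AnalyticMuLE W p 0`,
  `hlam4 : AnalyticLambdaEq W p 4`, `hk : ∀ Dq, k ≤ ord_p 𝓛_p(Dq)`, `hv` (every `IsSplitMultCanonical`
  §4.2 height datum with `Reg_p ≠ 0` has `v ≤ ord_p Reg_p`), `hb : 2 + 2·ord_p #E(ℚ)_tors < k + v + ord_p ∏c_ℓ`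
  ⟹ `X2.MazurMainConjectureAt W p`.
* §2 `…_of_not_dvd_torsionOrder` — the same with `p ∤ #E(ℚ)_tors` and `hb : 3 ≤ k + v + ord_p ∏c_ℓ`
  (the census norm on row B11: no rational `p`-torsion at a reducible `p ‖ N` with `r = 1`).
* §3 `mazurMC_and_bsdp_of_cellC_of_split_of_routeP_of_l3Certificate` — route P + the pair's L3
  certificate (k5-p3's door, `hcert` for THE split Mazur–Tate–Teitelbaum function and THE §4.2 height,
  `hsha : p ∤ #Ш_an`) ⟹ `X2.MazurMainConjectureAt W p ∧ BSDp W p`.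
Class-level binders, all REGISTERED Literature facts BY NAME: `hWu` Wuthrich 2014 Thm. 16, `hJs`/`hJn`
Stein–Wuthrich 2013 Thm. 6.1, `h310` Greenberg LNM 1716 Prop. 3.10, `hGZK` GZK (+ `hGZ` Gross–Zagier
I.7.3 and `hpar` modular parametrisation in §3). No Greenberg–Vatsal parity (BOTH ψ-parities), no
partner / relative / twist, no anticyclotomic object, no `_OPEN` / preprint fact.

INSTRUMENTS (all of record, two engines each; this door asks NO `p`-adic `L`-series coefficient beyond
`(μ, λ)`): `(μ_an, λ_an) = (0, 4)` — A PARI `ellpadiclambdamu` ‖ B msengine (`LAMMIN-CLASS-typer6.tsv`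
410e6fe6d9b80fa9, window N < 2·10⁴; engine C v5 of this seat as third leg); `k = ord_p 𝓛_p` — PARI Tate
`q` ‖ own `q` by `j`-inversion (k5-p3 JOB DESIGN #39 LEG W-H2, `R4`); `v = ord_p Reg_p` of THE split §4.2
height — PARI `ellpadicregulator` ‖ census REG-MULT σ-height (`R3_e1`/`R3_e2`, 749/749 window cells
agree); `#tors`, `∏c_ℓ` Cremona `allbsd`. Window candidates: 137 split `λ_an = 4` cells @3 + 5 @5
(k5-p3 `fold/B11-L3W1-keys.v1.tsv`).

What this is NOT: not a class theorem; not a booking; not the crux; not `BSD(E,p)` (§3 takes it from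
the L3 door); cells with `Ш(E)[p] ≠ 0` are out of reach of the inequality.
Refs: [GreenbergLNM1716] Prop. 3.10, §5 p. 183 (printed p. 142); [Wuthrich2014] Thm. 16 (p. 397);
[SteinWuthrich2013] Thm. 6.1 (p. 20), §4.2, §4.4; [GreenbergVatsal2000] p. 4; [Miller2011LMS] Def. 1.1,
Prop. 7.6; k5-c4 MEMO-7 §5 V9.
-/

set_option autoImplicit false
set_option linter.dupNamespace false

noncomputable section

open scoped Classical MatrixGroups ModularForm

open WeierstrassCurve PowerSeries CongruenceSubgroup
  Literature.NumberTheory.EllipticCurves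
  Literature.NumberTheory.EllipticCurves.ModularForms
  Literature.NumberTheory.EllipticCurves.Rank1Residual
  Literature.NumberTheory.EllipticCurves.Greenberg1999
  Literature.NumberTheory.EllipticCurves.Wuthrich2014
  Literature.NumberTheory.EllipticCurves.SteinWuthrich2013
  Summit.BirchSwinnertonDyer.Rank1Residual
  Summit.BirchSwinnertonDyer.Rank1Residual.X2

namespace Summit.BirchSwinnertonDyer.BirchSwinnertonDyer.Theorems.B11SplitRouteP

variable (W : WeierstrassCurve ℚ) [W.IsElliptic] [W.IsGloballyMinimal] (p : ℕ) [Fact p.Prime]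

/-! ## §1 The door (any rational torsion) -/

/-- **X2c ∧ SPLIT ∧ `(μ_an, λ_an) = (0, 4)` ∧ certified `k ≤ ord_p 𝓛_p`, `v ≤ ord_p Reg_p` with
`2 + 2·ord_p #tors < k + v + ord_p ∏c_ℓ` ⟹ Mazur's (cyclotomic) main conjecture at the pair** — both
ψ-parities, no partner, no preprint. Route P at rank one, split branch
(`X2.cellC_mazurMainConjectureAt_of_routeP`: Kato–Wuthrich divisibility + Greenberg's parity Prop. 3.10 +
Stein–Wuthrich Thm. 6.1 with THE §4.2 split height); THE §4.2 heights exist by the tree theorems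
`exists_isSplitMultCanonical_holds` / `exists_isMultCanonical_holds` (discharged inside).
[cite: GreenbergLNM1716, Prop. 3.10 and §5 p. 183] [cite: Wuthrich2014, Thm. 16 (p. 397)]
[cite: SteinWuthrich2013, Thm. 6.1 (p. 20), §4.2, §4.4 (p. 18)] [cite: GreenbergVatsal2000, p. 4 (after Thm. (1.2))] -/
theorem mazurMC_of_cellC_of_split_of_routeP
    (hWu : thm16_charIdeal_dvd_multiplicative_of_reducible)
    (hJs : thm61_splitMultiplicative) (hJn : thm61_nonsplitMultiplicative)
    (h310 : prop310_selmerCorank_mod_two_eq_lambdaInvariant)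
    (hGZK : rank_eq_analyticRank_of_analyticRank_le_one)
    (hc : CellC W p) (hsplit : W.HasSplitMultiplicativeReductionAtPrime p)
    (hμ0 : AnalyticMuLE W p 0) (hlam4 : AnalyticLambdaEq W p 4) {k v : ℤ}
    (hk : ∀ Dq : TateParameterData W p, k ≤ (LInvariant Dq).valuation)
    (hv : ∀ (Dq : TateParameterData W p) (Dh : PAdicHeightData W p), IsSplitMultCanonical Dh Dq →
      padicRegulator Dh ≠ 0 → v ≤ (padicRegulator Dh).valuation)
    (hb : 2 + 2 * (padicValNat p W.torsionOrder : ℤ) < k + v + padicValNat p W.tamagawaProduct) :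
    MazurMainConjectureAt W p :=
  cellC_mazurMainConjectureAt_of_routeP hWu hJs hJn exists_isSplitMultCanonical_holds
    exists_isMultCanonical_holds h310 hGZK W p hc hμ0 (fun hns ↦ absurd hsplit hns)
    (fun hns ↦ absurd hsplit hns) (fun _ ↦ hlam4) (fun _ ↦ ⟨k, v, hk, hv, hb⟩)

/-! ## §2 No rational `p`-torsion -/

/-- **The same door when `p ∤ #E(ℚ)_tors`** (the census norm on row B11): the inequality reads
`3 ≤ k + v + ord_p ∏c_ℓ` — e.g. `k = 1, v = 2`, or `k = v = 1 ∧ p ∣ ∏c_ℓ`.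
[cite: GreenbergLNM1716, Prop. 3.10 and §5 p. 183] [cite: SteinWuthrich2013, Thm. 6.1 (p. 20), §4.2, §4.4 (p. 18)] -/
theorem mazurMC_of_cellC_of_split_of_routeP_of_not_dvd_torsionOrder
    (hWu : thm16_charIdeal_dvd_multiplicative_of_reducible)
    (hJs : thm61_splitMultiplicative) (hJn : thm61_nonsplitMultiplicative)
    (h310 : prop310_selmerCorank_mod_two_eq_lambdaInvariant)
    (hGZK : rank_eq_analyticRank_of_analyticRank_le_one)
    (hc : CellC W p) (hsplit : W.HasSplitMultiplicativeReductionAtPrime p)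
    (hμ0 : AnalyticMuLE W p 0) (hlam4 : AnalyticLambdaEq W p 4)
    (htors : ¬ p ∣ W.torsionOrder) {k v : ℤ}
    (hk : ∀ Dq : TateParameterData W p, k ≤ (LInvariant Dq).valuation)
    (hv : ∀ (Dq : TateParameterData W p) (Dh : PAdicHeightData W p), IsSplitMultCanonical Dh Dq →
      padicRegulator Dh ≠ 0 → v ≤ (padicRegulator Dh).valuation)
    (hb : 3 ≤ k + v + padicValNat p W.tamagawaProduct) :
    MazurMainConjectureAt W p := by
  have ht0 : padicValNat p W.torsionOrder = 0 := padicValNat.eq_zero_of_not_dvd htors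
  refine mazurMC_of_cellC_of_split_of_routeP W p hWu hJs hJn h310 hGZK hc hsplit hμ0 hlam4 hk hv ?_
  rw [ht0, Nat.cast_zero, mul_zero, add_zero]
  linarith

/-! ## §3 Route P + the pair's L3 certificate: the main conjecture AND `BSD(E,p)` -/

/-- **X2c ∧ SPLIT: route P (`(μ_an, λ_an) = (0, 4)`, `k`, `v`, inequality) AND the pair's L3 certificate
(`ord_{T=0} L = 2` with the Stein–Wuthrich Conj. 5.1 quotient a `p`-adic unit, for THE split
Mazur–Tate–Teitelbaum function and THE §4.2 height) AND `p ∤ #Ш_an` ⟹ Mazur's main conjecture at the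
pair AND `BSD(E,p)`** — §1 for the main conjecture, k5-p3's door
`B11L3.bsdp_of_cellC_of_split_of_thm16_of_l3Certificate` (Kato–Wuthrich + Stein–Wuthrich + the
certificate) for `BSD(E,p)`. [cite: GreenbergLNM1716, Prop. 3.10 and §5 p. 183]
[cite: Wuthrich2014, Thm. 16 (p. 397)] [cite: SteinWuthrich2013, Thm. 6.1 (p. 20) and §4.2]
[cite: Miller2011LMS, Def. 1.1 and Prop. 7.6] -/
theorem mazurMC_and_bsdp_of_cellC_of_split_of_routeP_of_l3Certificate
    (hWu : thm16_charIdeal_dvd_multiplicative_of_reducible)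
    (hJs : thm61_splitMultiplicative) (hJn : thm61_nonsplitMultiplicative)
    (h310 : prop310_selmerCorank_mod_two_eq_lambdaInvariant)
    (hGZ : GrossZagier1986_thm_I_7_3) (hGZK : rank_eq_analyticRank_of_analyticRank_le_one)
    (hpar : nonempty_modularParametrizationData)
    (hc : CellC W p) (hsplit : W.HasSplitMultiplicativeReductionAtPrime p)
    (hμ0 : AnalyticMuLE W p 0) (hlam4 : AnalyticLambdaEq W p 4) {k v : ℤ}
    (hk : ∀ Dq : TateParameterData W p, k ≤ (LInvariant Dq).valuation)
    (hv : ∀ (Dq : TateParameterData W p) (Dh : PAdicHeightData W p), IsSplitMultCanonical Dh Dq →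
      padicRegulator Dh ≠ 0 → v ≤ (padicRegulator Dh).valuation)
    (hb : 2 + 2 * (padicValNat p W.torsionOrder : ℤ) < k + v + padicValNat p W.tamagawaProduct)
    (hcert : ∀ {N : ℕ} [NeZero N] (f : CuspForm (Gamma0 N) 2), IsNewformOf W f →
      ∀ (ϖ : ℚ), (ϖ : ℝ) * W.realPeriodRat = plusPeriod f →
      ∀ (L : PowerSeries ℚ_[p]), IsSplitMultPAdicLFunctionOf f p L →
      ∀ (Dq : TateParameterData W p) (Dh : PAdicHeightData W p), IsSplitMultCanonical Dh Dq →
        L.order = ((2 : ℕ) : ℕ∞) ∧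
        (((ϖ : ℚ) : ℚ_[p]) * PowerSeries.coeff 2 L *
            (padicLog p (cyclotomicGenerator p) ^ 2 * (W.torsionOrder : ℚ_[p]) ^ 2)).valuation =
          (LInvariant Dq * (W.tamagawaProduct : ℚ_[p]) * padicRegulator Dh).valuation)
    (hsha : ∀ s : ℚ, shaAn W = (s : ℂ) → padicValRat p s = 0) :
    MazurMainConjectureAt W p ∧ BSDp W p :=
  ⟨mazurMC_of_cellC_of_split_of_routeP W p hWu hJs hJn h310 hGZK hc hsplit hμ0 hlam4 hk hv hb,
    B11L3.bsdp_of_cellC_of_split_of_thm16_of_l3Certificate W p hWu hJs hGZ hGZK hpar hc hsplit hcert hsha⟩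

end Summit.BirchSwinnertonDyer.BirchSwinnertonDyer.Theorems.B11SplitRouteP

end
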